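import Summits.BirchSwinnertonDyer.Rank1Residual.GaloisImage.PropagatedStructure
import Literature.NumberTheory.EllipticCurves.TateModuleProjSurjectiveProofs
import HarnessLib

/-!
# `ker(π_{k+1,*}) ⊆ p^{k+1} · H¹(G, T_pE)` for ANY topological group `G` acting through `Γ_ℚ`
# (clause (C1.c)/COMPAT of the fine Kato package ⟨C1⟩ = `stub_fineKato` of crux
# `KatoKuriharaPortThreeShared`, stmt-BirchSwinnertonDyer-19560; cell `bsd-addord`, seat w2-acc5 gen 4;
# route W2 `KimAtThreeKolyvagin`; `--supports 19560`, helper)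

HONEST FRAMING. TOOL theorems only (no definition, no named fact, no `sorry`); closes nothing; nothing
is booked; BSD is not proved by any of this.  This is kim3 gen 13's exactness step
`KimAtThreeFineKatoLocalExactness.exists_eq_zsmul_of_tateLocalMap_eq_zero` — there for `Γ_{ℚ_v}` acting
through `absGaloisRestrict ℚ ℚ_v` (`tateLocalRep W p v`) — re-run VERBATIM for an ARBITRARY topological
group `G` acting on `T_pE` and `E[p^{k+1}]` through a continuous homomorphism `φ : G →ₜ* Γ_ℚ`
(`ContinuousRep.restrict φ`).  Why: the semi-local COMPAT clause of ⟨C1⟩ (kim3 STATUS l.1128 / w2-c3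
X1-int) compares a class over `ℚ_p` with a LEVEL class localised at a completion `K_w = ℚ(μ_m)_w ⊋ ℚ_p`
of the level field; the comparison lives in `H¹(Γ_{K_w}, ·)` with `Γ_{K_w}` acting through the TOWER
`Γ_{K_w} → Γ_{ℚ_p} → Γ_ℚ` (`Literature/…/LevelFieldLocalization`: `absGaloisRestrictTower`,
`locTower_resSubgroup`), where `π_{k+1,*}(res h − loc_w y) = 0` must yield
`res h − loc_w y ∈ p^{k+1} · H¹(K_w, T_pE)`.  Instances of `φ`: `absGaloisRestrict ℚ F` (any field
`F ⊇ ℚ`: the direct local representation, kim3's case `F = ℚ_v` included definitionally),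
`absGaloisRestrictTower ℚ E F` (tower), `U.subtype` (a level), `id` (global).

* `exists_eq_zsmul_of_cohomologyMap_eq_zero` — **if `π_{k+1,*}[η] = 0` in `H¹(G, E[p^k·p])` then
  `[η] = p^{k+1} · [η″]` in `H¹(G, T_pE)`** (cocycle level: `π ∘ η = ∂t`, lift `t` to `T_pE` by
  `proj_surjective_of_isAlgClosed_holds`, divide `η − ∂t̃` by `p^{k+1}` with `tateDivPow`; no `H²`).
* `pow_zsmul_cohomology_torsion_eq_zero` — `p^k·p` kills `H¹(G, E[p^k·p])`.

References: J. H. Silverman, *AEC* III.§7 [SilvermanAEC2009]; J.-P. Serre, *Galois Cohomology* I.§2.2,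
I.§5.1 [SerreGaloisCohomology1997]; C.-H. Kim, AJM 148 (2026) §3.3 Lemma 3.11 [Kim2022StructureSelmer];
kim3 `Theorems/KimAtThreeFineKatoLocalExactness.lean` (p489562).
-/

noncomputable section

-- the cell's Theorems namespace `Summit.BirchSwinnertonDyer.BirchSwinnertonDyer.…` repeats the summit name by design (D-0017)
set_option linter.dupNamespace false

open scoped Classical NumberField ContRepresentation
open Field NumberField IsDedekindDomain
open WeierstrassCurve Literature.NumberTheory.EllipticCurves Literature.NumberTheory.GaloisRepresentations
  Literature.NumberTheory.GaloisRepresentations.DiscreteGaloisModule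
open Summit.BirchSwinnertonDyer.Rank1Residual.GaloisImage

namespace Summit.BirchSwinnertonDyer.BirchSwinnertonDyer.Theorems.KimAtThreeFineKatoLevelExactness

variable (W : WeierstrassCurve ℚ) (p : ℕ) [hp : Fact p.Prime] [W.IsElliptic] (k : ℕ)
variable {G : Type} [Group G] [TopologicalSpace G] [IsTopologicalGroup G]
  (φ : G →ₜ* absoluteGaloisGroup ℚ)

omit [W.IsElliptic] [IsTopologicalGroup G] in
/-- Unfolding the `G`-action on `T_pE` through `φ`: `g ↦ (φ g) • a`. [folklore] -/
theorem restrict_tate_apply (g : G) (a : W.tateModule p) :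
    ((W.tateGaloisRep p (W.continuous_galoisRepTate_holds p)).toIntRep.restrict φ) g a = φ g • a := rfl

omit [W.IsElliptic] [IsTopologicalGroup G] in
/-- The orbit map `g ↦ (φ g) • a` of `G` on `T_pE` is continuous (joint continuity of the
`Γ_ℚ`-action, `continuousSMul_geomPoints'` + `TateModule.continuousSMul_of_continuousSMul`). [folklore] -/
theorem continuous_restrict_tate_apply (a : W.tateModule p) :
    Continuous fun g : G =>
      ((W.tateGaloisRep p (W.continuous_galoisRepTate_holds p)).toIntRep.restrict φ).toTopRep.ρ g a := by
  haveI := continuousSMul_geomPoints' W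
  haveI := TateModule.continuousSMul_of_continuousSMul (A := geomPoints W) (p := p)
    (G := absoluteGaloisGroup ℚ)
  have h2 : Continuous fun g : G => φ g • a := (map_continuous φ).smul continuous_const
  refine (continuous_congr fun g => ?_).mpr h2
  rw [ContinuousRep.toTopRep_ρ_apply, restrict_tate_apply]

omit [W.IsElliptic] [IsTopologicalGroup G] in
/-- `π_{k+1}` is `G`-equivariant for the actions through `φ`. [folklore] -/
theorem tateToTorsion_restrict_apply (g : G) (a : W.tateModule p) :
    tateToTorsion W p k (((W.tateGaloisRep p (W.continuous_galoisRepTate_holds p)).toIntRep.restrict φ) g a) =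
      ((W.torsionGaloisModule ((p : ℤ) ^ k * (p : ℤ))).restrict φ) g (tateToTorsion W p k a) :=
  Subtype.ext rfl

omit [W.IsElliptic] in
/-- **`π_{k+1,*}[η] = [π_{k+1} ∘ η]`** for the map `H¹(G, T_pE) → H¹(G, E[p^k·p])` induced by
`π_{k+1}` (`ContinuousRep.cohomologyMap`), on an explicit crossed homomorphism `η`. [folklore] -/
theorem cohomologyMap_tateToTorsion_oneCocycleClass
    (η : contOneCocycles
      ((W.tateGaloisRep p (W.continuous_galoisRepTate_holds p)).toIntRep.restrict φ).toTopRep) :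
    ContinuousRep.cohomologyMap
        ((W.tateGaloisRep p (W.continuous_galoisRepTate_holds p)).toIntRep.restrict φ)
        ((W.torsionGaloisModule ((p : ℤ) ^ k * (p : ℤ))).restrict φ)
        (tateToTorsion W p k) (continuous_tateToTorsion W p k)
        (tateToTorsion_restrict_apply W p k φ) 1 (oneCocycleClass _ η) =
      oneCocycleClass _ (contOneCocycles.pullback (ContinuousMonoidHom.id G)
        (X := ((W.tateGaloisRep p (W.continuous_galoisRepTate_holds p)).toIntRep.restrict φ).toTopRep)
        (Y := ((W.torsionGaloisModule ((p : ℤ) ^ k * (p : ℤ))).restrict φ).toTopRep)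
        (TopRep.ofHom ⟨⟨(tateToTorsion W p k).toIntLinearMap, continuous_tateToTorsion W p k⟩,
          fun g => ContinuousLinearMap.ext fun a => tateToTorsion_restrict_apply W p k φ g a⟩) η) :=
  map_oneCocycleClass _ _ _ η

omit [W.IsElliptic] [IsTopologicalGroup G] in
/-- The pushed-forward cocycle, pointwise: `(π_{k+1} ∘ η)(g) = π_{k+1}(η g)`. [folklore] -/
theorem pullback_tateToTorsion_apply
    (η : contOneCocycles
      ((W.tateGaloisRep p (W.continuous_galoisRepTate_holds p)).toIntRep.restrict φ).toTopRep) (g : G) :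
    (contOneCocycles.pullback (ContinuousMonoidHom.id G)
        (X := ((W.tateGaloisRep p (W.continuous_galoisRepTate_holds p)).toIntRep.restrict φ).toTopRep)
        (Y := ((W.torsionGaloisModule ((p : ℤ) ^ k * (p : ℤ))).restrict φ).toTopRep)
        (TopRep.ofHom ⟨⟨(tateToTorsion W p k).toIntLinearMap, continuous_tateToTorsion W p k⟩,
          fun g => ContinuousLinearMap.ext fun a => tateToTorsion_restrict_apply W p k φ g a⟩) η).1 g =
      tateToTorsion W p k (η.1 g) := rfl

/-- **`ker π_{k+1,*} ⊆ p^{k+1} · H¹(G, T_pE)`** for any topological group `G` acting through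
`φ : G →ₜ* Γ_ℚ` (exactness of `0 → T_pE →(p^{k+1}) T_pE →(π_{k+1}) E[p^{k+1}] → 0` at `H¹(G, T_pE)`,
cocycle level, no `H²`): if `π_{k+1,*}[η] = 0` then `π_{k+1} ∘ η = ∂t` with `t ∈ E[p^{k+1}]`; lift `t` to
`t̃ ∈ T_pE` (`proj_surjective_of_isAlgClosed_holds`), so `η − ∂t̃` takes values in
`ker π_{k+1} = p^{k+1} T_pE`, and its shift `(η − ∂t̃)/p^{k+1}` (`tateDivPow`) is a continuous crossed
homomorphism `η″` with `[η] = p^{k+1} · [η″]`.  kim3's `exists_eq_zsmul_of_tateLocalMap_eq_zero` is the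
case `φ = absGaloisRestrict ℚ ℚ_v`. [cite: SilvermanAEC2009, III.§7 (definition of `T_ℓ(E)`, p. 87)] -/
theorem exists_eq_zsmul_of_cohomologyMap_eq_zero
    (y : ((W.tateGaloisRep p (W.continuous_galoisRepTate_holds p)).toIntRep.restrict φ).cohomology 1)
    (hy : ContinuousRep.cohomologyMap
        ((W.tateGaloisRep p (W.continuous_galoisRepTate_holds p)).toIntRep.restrict φ)
        ((W.torsionGaloisModule ((p : ℤ) ^ k * (p : ℤ))).restrict φ)
        (tateToTorsion W p k) (continuous_tateToTorsion W p k)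
        (tateToTorsion_restrict_apply W p k φ) 1 y = 0) :
    ∃ y' : ((W.tateGaloisRep p (W.continuous_galoisRepTate_holds p)).toIntRep.restrict φ).cohomology 1,
      y = ((p : ℤ) ^ (k + 1)) • y' := by
  obtain ⟨η, rfl⟩ :=
    oneCocycleClass_surjective ((W.tateGaloisRep p (W.continuous_galoisRepTate_holds p)).toIntRep.restrict φ).toTopRep y
  have hy' := (cohomologyMap_tateToTorsion_oneCocycleClass W p k φ η).symm.trans hy
  obtain ⟨t, ht⟩ := (oneCocycleClass_eq_zero_iff _ _).mp hy'
  -- `ht g`, on underlying points: `(η g)_{k+1} = φ g • t - t`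
  have ht' : ∀ g : G, TateModule.proj p (k + 1) (η.1 g) =
      φ g • (t : geomPoints W) - (t : geomPoints W) := by
    intro g
    exact congrArg (fun P : geomTorsion W ((p : ℤ) ^ k * (p : ℤ)) => (P : geomPoints W)) (ht g)
  -- lift `t` to `T_pE` and absorb its coboundary into `η`
  obtain ⟨tT, htT⟩ := proj_surjective_of_isAlgClosed_holds W p (k + 1)
    ((mem_geomTorsion_pow_mul_iff W p k _).mp t.2)
  set η' : contOneCocycles
      ((W.tateGaloisRep p (W.continuous_galoisRepTate_holds p)).toIntRep.restrict φ).toTopRep :=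
    η - principalCocycle _ tT (continuous_restrict_tate_apply W p φ tT) with hη'
  have hη'apply : ∀ g : G, η'.1 g = η.1 g -
      (((W.tateGaloisRep p (W.continuous_galoisRepTate_holds p)).toIntRep.restrict φ).toTopRep.ρ g tT - tT) :=
    fun g => rfl
  -- `(η' g)_{k+1} = 0`
  have hk0 : ∀ g : G, TateModule.proj p (k + 1) (η'.1 g) = 0 := by
    intro g
    rw [hη'apply, map_sub, map_sub, ContinuousRep.toTopRep_ρ_apply, restrict_tate_apply,
      TateModule.proj_smul_of_distribMulAction, htT, ht' g, sub_self]
  -- the divided crossed homomorphism `η'' = η' / p^{k+1}`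
  let f'' : G → W.tateModule p := fun g => tateDivPow (k + 1) (η'.1 g) (hk0 g)
  have hf''val : ∀ (g : G) (n : ℕ),
      TateModule.proj p n (f'' g) = TateModule.proj p (n + (k + 1)) (η'.1 g) := fun g n => rfl
  have hcont'' : Continuous f'' :=
    continuous_induced_rng.2
      (continuous_pi fun n => (TateModule.continuous_proj (n + (k + 1))).comp η'.1.continuous)
  have hcoc'' : ∀ g h : G, f'' (g * h) = f'' g +
      ((W.tateGaloisRep p (W.continuous_galoisRepTate_holds p)).toIntRep.restrict φ).toTopRep.ρ g (f'' h) := by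
    intro g h
    apply TateModule.ext
    intro n
    rw [hf''val, map_add, hf''val, ContinuousRep.toTopRep_ρ_apply, restrict_tate_apply,
      TateModule.proj_smul_of_distribMulAction, hf''val, η'.2 g h, map_add,
      ContinuousRep.toTopRep_ρ_apply, restrict_tate_apply, TateModule.proj_smul_of_distribMulAction]
  let η'' : contOneCocycles
      ((W.tateGaloisRep p (W.continuous_galoisRepTate_holds p)).toIntRep.restrict φ).toTopRep :=
    ⟨⟨f'', hcont''⟩, hcoc''⟩
  have hη''apply : ∀ g : G, η''.1 g = f'' g := fun g => rfl
  -- `η' = p^{k+1} • η''`, pointwise then as cocycles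
  have hpt : ∀ g : G, η'.1 g = ((p : ℤ) ^ (k + 1)) • η''.1 g := by
    intro g
    apply TateModule.ext
    intro n
    rw [map_zsmul, hη''apply, hf''val, ← Nat.cast_pow, natCast_zsmul, add_comm n (k + 1),
      TateModule.pow_smul_proj_self_add]
  have hsmul : η' = ((p : ℤ) ^ (k + 1)) • η'' := by
    apply Subtype.ext
    apply ContinuousMap.ext
    intro g
    rw [hpt g]
    simp
  -- `[η] = [η'] = p^{k+1} • [η'']`
  refine ⟨oneCocycleClass _ η'', ?_⟩
  have hcls : oneCocycleClass _ η =
      oneCocycleClass ((W.tateGaloisRep p (W.continuous_galoisRepTate_holds p)).toIntRep.restrict φ).toTopRep η' := by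
    rw [hη', oneCocycleClass_sub, oneCocycleClass_principalCocycle, sub_zero]
  rw [hcls, hsmul]
  exact map_zsmul (oneCocycleClassₗ
    ((W.tateGaloisRep p (W.continuous_galoisRepTate_holds p)).toIntRep.restrict φ).toTopRep).toAddMonoidHom _ η''

omit hp [W.IsElliptic] in
/-- **A class of `H¹(G, E[p^k·p])` is killed by `p^k·p`** (its coefficients are), for any `G` acting
through `φ`. [folklore] -/
theorem pow_zsmul_cohomology_torsion_eq_zero
    (x : ((W.torsionGaloisModule ((p : ℤ) ^ k * (p : ℤ))).restrict φ).cohomology 1) :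
    ((p : ℤ) ^ k * (p : ℤ)) • x = 0 := by
  obtain ⟨ξ, rfl⟩ :=
    oneCocycleClass_surjective ((W.torsionGaloisModule ((p : ℤ) ^ k * (p : ℤ))).restrict φ).toTopRep x
  have hξ : ((p : ℤ) ^ k * (p : ℤ)) • ξ = 0 := by
    apply Subtype.ext
    apply ContinuousMap.ext
    intro g
    rw [AddSubgroupClass.coe_zsmul, ContinuousMap.zsmul_apply, Submodule.coe_zero,
      ContinuousMap.zero_apply]
    apply Subtype.ext
    have hmem := (ξ.1 g).2
    rw [mem_geomTorsion_iff] at hmem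
    rw [AddSubgroupClass.coe_zsmul]
    exact hmem
  have h := map_zsmul (oneCocycleClassₗ
    ((W.torsionGaloisModule ((p : ℤ) ^ k * (p : ℤ))).restrict φ).toTopRep).toAddMonoidHom
    ((p : ℤ) ^ k * (p : ℤ)) ξ
  rw [LinearMap.toAddMonoidHom_coe, oneCocycleClassₗ_apply, hξ, oneCocycleClassₗ_apply,
    oneCocycleClass_zero] at h
  exact h.symm

/-- **The difference of two lifts lies in `p^{k+1} · H¹(G, T_pE)`**: if `π_{k+1,*} y₁ = π_{k+1,*} y₂`
then `y₁ − y₂ = p^{k+1} · y'` — the form used by the semi-local COMPAT clause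
(`y₁ = res_{K_w/ℚ_p} h`, `y₂ = loc_w y`, both over `G = Γ_{K_w}` through the tower).
[cite: Kim2022StructureSelmer, §3.3 Lemma 3.11] -/
theorem exists_sub_eq_zsmul_of_cohomologyMap_eq
    (y₁ y₂ : ((W.tateGaloisRep p (W.continuous_galoisRepTate_holds p)).toIntRep.restrict φ).cohomology 1)
    (h : ContinuousRep.cohomologyMap
        ((W.tateGaloisRep p (W.continuous_galoisRepTate_holds p)).toIntRep.restrict φ)
        ((W.torsionGaloisModule ((p : ℤ) ^ k * (p : ℤ))).restrict φ)
        (tateToTorsion W p k) (continuous_tateToTorsion W p k)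
        (tateToTorsion_restrict_apply W p k φ) 1 y₁ =
      ContinuousRep.cohomologyMap
        ((W.tateGaloisRep p (W.continuous_galoisRepTate_holds p)).toIntRep.restrict φ)
        ((W.torsionGaloisModule ((p : ℤ) ^ k * (p : ℤ))).restrict φ)
        (tateToTorsion W p k) (continuous_tateToTorsion W p k)
        (tateToTorsion_restrict_apply W p k φ) 1 y₂) :
    ∃ y' : ((W.tateGaloisRep p (W.continuous_galoisRepTate_holds p)).toIntRep.restrict φ).cohomology 1,
      y₁ - y₂ = ((p : ℤ) ^ (k + 1)) • y' :=
  exists_eq_zsmul_of_cohomologyMap_eq_zero W p k φ (y₁ - y₂) (by rw [map_sub, h, sub_self])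

end Summit.BirchSwinnertonDyer.BirchSwinnertonDyer.Theorems.KimAtThreeFineKatoLevelExactness

end
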